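import Summits.BirchSwinnertonDyer.BirchSwinnertonDyer.Theorems.TeichmullerTwistDescentKummerCornerOfStarredClass
import Summits.BirchSwinnertonDyer.BirchSwinnertonDyer.Theorems.TeichmullerTwistDescentStarInvolutionSandwich
import Summits.BirchSwinnertonDyer.Rank1Residual.Additive.GordManinConstantTwistDegree
import HarnessLib

/-!
# Route `TeichmullerTwistDescent`: Edixhoven's "case 2" at EVERY `p ≥ 5` from the five named inputs of K —
# the unstarred and starred optimal Manin constants have EQUAL `p`-adic valuation, and every parametrisation
# of the `p*`-twist has modular degree divisible by `p` (F″-free; `--supports stmt-BirchSwinnertonDyer-24306`)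

Cell `pub/bsd-wall` (D-0145 line route-BirchSwinnertonDyer-TeichmullerTwistDescent, OPEN rev 8), seat `bsd-line-ttd-p1`
(prover 1/2, g30).  THEOREMS ONLY (no definition, no named fact, no `sorry`).  BSD is not proved by this file; no item is
closed by it; CORNER (stmt-BirchSwinnertonDyer-23883) / WILD (24306) / TAME (24307) are NOT proved.

WHAT.  Edixhoven (1991 §4, typescript L985–L1047; thesis 1989 Prop. 4.5.2 / Thm. 4.6.3) splits an additive potentially good
ordinary twist pair (`E` unstarred of type II/III/IV, `Ẽ` the optimal curve of the `p*`-twisted, starred class) into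
"case 1" (`Λ̃ = δΛ`, `deg φ̃ = p⁻¹·deg φ`, `v_p(c̃) = v_p(c) − 1`) and "case 2" (`Λ̃ = δ⁻¹Λ`, `deg φ̃ = p·deg φ`,
`v_p(c̃) = v_p(c)`); case 1 would contradict Manin's conjecture.  The tree already holds the dichotomy at every
`p ≥ 5` as the sandwich `ord_p c♭ ≤ ord_p c ≤ ord_p c♭ + 1` (`padicValInt_c_sandwich_of_optimal_star_pair`, Modularity only)
and the `p`-adic twist identity `v_p(deg♭) + 2·v_p(c) = v_p(deg) + 2·v_p(c♭) + 1` (`Additive.padicVal_twist_identity`, Zagier's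
degree formula, a tree theorem); and, since g29, K₅ — twisted period-lattice saturation at every `p ≥ 5` from the five named
published inputs of K (`KFive.twistedPeriodLatticeSaturation_five_of_named_inputs`).  This file combines them:

* §1 `KFive.padicValInt_c_le_twist_datum_of_named_inputs` — for `W` globally minimal, `5 ≤ p`, additive, (G)-ordinary with
  `ord_pΔ_min ≤ 4`, `E[p]` irreducible, `D` LATTICE-OPTIMAL at the conductor level, `V = C • W ⊗ χ_{p*}` globally minimal and
  `D'` ANY conductor-level datum of `V`: **`ord_p c(D) ≤ ord_p c(D')`** (the valuation form of g29's
  `KFive.not_dvd_c_of_named_inputs_of_starredClass`: K₅ + the loss-free star involution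
  `padicValInt_c_add_le_of_twist_datum_of_saturation` + `ord_p u(C) = 0`).
* §2 `KFive.succ_padicValNat_modularDegree_le_twist_of_named_inputs`, `KFive.dvd_modularDegree_twist_of_named_inputs` —
  **`v_p(deg D) + 1 ≤ v_p(deg D')`**, in particular **`p ∣ deg(D')` for EVERY parametrisation datum of the twist**: the
  census law "`p ∣ deg` always on the starred partner" (`Additive.dvd_modularDegree_twist_of_not_dvd` needs `p ∤ deg D`
  and ČNS) here WITHOUT any degree hypothesis, F″-free and ČNS-free, from the five prints.
* §3 `KFive.padicValInt_c_eq_of_optimal_star_pair_of_named_inputs` — for the OPTIMAL star pair (`(W, D)` as in §1,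
  `(W♭, D♭)` the starred optimal partner: globally minimal, additive, potentially good with `6 < ord_pΔ_min`, the classes
  `p*`-twists of each other, `D♭` lattice-optimal): **`ord_p c(D) = ord_p c(D♭)`** — Edixhoven's CASE 2 / the EXCLUSION of
  case 1 at every `p ≥ 5`, granted Modularity and the five prints (the lower bound is the sandwich, the upper bound §1 fed
  with the datum of `W♭` transported prime-to-`p` to `V`, `exists_datum_padicValInt_eq_of_partner`); and the iff form
  `KFive.not_dvd_c_iff_of_optimal_star_pair_of_named_inputs`: the unstarred curve's Manin unit is EQUIVALENT to the
  starred partner's.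
* §4 the Kummer corner (`(p, ord_pΔ) ∈ {(5, 3), (7, 2)}`, the binders of CORNER / WILD / TAME):
  `KFive.kummerCorner_padicValInt_c_eq_starred_of_named_inputs` (CORNER's curve and its starred optimal partner — III* at 5,
  IV* at 7 — have the SAME Manin `p`-part) and `KFive.kummerCorner_dvd_modularDegree_twist_of_named_inputs`.

So at the corner the F″-free state of the art reads: CORNER ⟺ the starred partner's Manin unit (both directions are now tree
theorems modulo the five prints + Modularity), the pair sits in Edixhoven's case 2 with `v_p(deg♭) ≥ v_p(deg) + 1`, and what
is missing is exactly Edixhoven's GEOMETRIC step (Prop. 8 / Lemma 4.6.4 "separable on a component ⇒ `p ∤ c`" together with the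
case-2 separability attribution of Prop. 4.5.2), which is printed only for `p > 7` and whose Raynaud input fails at `e = p − 1`
(seat memo KLINE-EDIX7-ttdp1g30.md).  Nothing here is new mathematics beyond bookkeeping of landed theorems.

References: [EdixhovenManin1991] §4 (typescript L985–L1047) and Thm. 3; [Edixhoven1989Thesis] Prop. 4.5.2, Thm. 4.6.3 (pp. 59–66);
[ZagierCMB1985] §1 (p. 374); [Stevens1989] Lemma (5.4); [Kraus1997Dissertationes] Prop. 1; [Edixhoven1992] Thm. 4.5.
-/

set_option autoImplicit false
-- single-conjunct summit: `Summit.BirchSwinnertonDyer.BirchSwinnertonDyer.…` repeats the name by design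
set_option linter.dupNamespace false

noncomputable section

open scoped Classical NumberField

open WeierstrassCurve IsDedekindDomain Rat.HeightOneSpectrum
  Literature.NumberTheory.EllipticCurves Literature.NumberTheory.EllipticCurves.ModularForms
  Literature.NumberTheory.EllipticCurves.Rank1Residual Literature.NumberTheory.DiophantineGeometry
  Summit.BirchSwinnertonDyer.Rank1Residual Summit.BirchSwinnertonDyer.Rank1Residual.Additive
  Summit.BirchSwinnertonDyer.BirchSwinnertonDyer.Theses.TeichmullerTwistDescent
  Summit.BirchSwinnertonDyer.BirchSwinnertonDyer.Theorems.TeichmullerTwistDescentStarInvolution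
open Literature.NumberTheory.Automorphic (edixhoven1992_serreWeight_le_weight_of_newform)

namespace Summit.BirchSwinnertonDyer.BirchSwinnertonDyer.Theorems.TeichmullerTwistDescent

namespace KFive

/-- Level bookkeeping: a datum at level `N` is a datum at any equal level with the same Manin valuation and the same degree
valuation. [folklore] -/
private theorem exists_datum_padicVal_eq_of_level_eq {W : WeierstrassCurve ℚ} {N M : ℕ} [NeZero N] [NeZero M]
    (h : N = M) (p : ℕ) (D : ModularParametrizationData W N) :
    ∃ D' : ModularParametrizationData W M,
      padicValInt p D'.c = padicValInt p D.c ∧ padicValNat p D'.modularDegree = padicValNat p D.modularDegree := by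
  subst h
  exact ⟨D, rfl, rfl⟩

/-! ### §1 The valuation form of the transferred K-line: `ord_p c(D) ≤ ord_p c(D')` for every datum of the twist -/

/-- **`ord_p c(D) ≤ ord_p c(D')` for every conductor-level datum `D'` of the `p*`-twist, from the five named inputs of K.**
`W/ℚ` globally minimal, `5 ≤ p`, additive and (G)-ordinary at `p` with `ord_pΔ_min ≤ 4` (Kodaira II/III/IV), `E[p]` irreducible,
`D` a LATTICE-OPTIMAL `X₀(N)`-datum (`Λ_E = c·Λ_f`); `V = C • W ⊗ χ_{p*}` globally minimal; `D'` any datum of `V` at a level equal to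
`N(W)` (`= N(V)`).  GRANTED modularity, the CDT tame type (central), the signed BDJ/AS weight statement, Kraus Prop. 1 and
Edixhoven 1992 Thm. 4.5 (which give K₅ at `(W, p, D, χ_{p*})`): `ord_p c(D) ≤ ord_p c(D')` — the loss-free star involution
`ord_p c(D) + ord_p u(C) ≤ ord_p c(D')` with `ord_p u(C) = 0`.  The valuation form of g29's
`not_dvd_c_of_named_inputs_of_starredClass`; Edixhoven's inclusion `Λ ⊆ δ·Λ̃` ("case 2 or CM") in datum language.
[cite: EdixhovenManin1991, §4 (typescript L985–L1010)] [cite: Stevens1989, Lemma (5.4) p. 97] -/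
theorem padicValInt_c_le_twist_datum_of_named_inputs (hnf : exists_isNewformOf)
    (hT : fullLevelHomology_isIsotypic_tamePrincipalSeries_of_central)
    (hWt : fullLevelHomology_twist_isModular_of_eigenMap_signed)
    (hKr : Kraus1997.propOne_inertiaShape_of_ordinary) (hEd : edixhoven1992_serreWeight_le_weight_of_newform)
    (W : WeierstrassCurve ℚ) [W.IsElliptic] [W.IsGloballyMinimal] (p : ℕ) [Fact p.Prime] [NeZero (W.conductorNorm ℤ)]
    (D : ModularParametrizationData W (W.conductorNorm ℤ)) (hp5 : 5 ≤ p)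
    (hadd : Addv W p) (hirr : Irr W p) (hG : TypeGOrd W p) (hV4 : padicValInt p W.minimalDiscriminantInt ≤ 4)
    (hopt : ∀ z ∈ D.L.lattice, ∃ w ∈ periodLattice D.f, z = D.c * w)
    (V : WeierstrassCurve ℚ) [V.IsElliptic] [V.IsGloballyMinimal] (C : VariableChange ℚ)
    (hC : C • W.quadraticTwist ((-1 : ℚ) ^ (p / 2) * p) = V)
    {N' : ℕ} [NeZero N'] (hN' : N' = W.conductorNorm ℤ) (D' : ModularParametrizationData V N') :
    padicValInt p D.c ≤ padicValInt p D'.c := by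
  have hp2 : p ≠ 2 := by omega
  have hj : 0 ≤ padicValRat p W.j := padicValRat_j_nonneg_of_typeGOrd W p hG
  have hW6 : padicValInt p W.minimalDiscriminantInt < 6 := by omega
  have hpN : p ^ 2 ∣ W.conductorNorm ℤ := sq_dvd_conductorNorm_of_not_good_of_not_mult hadd
  obtain ⟨hV, -, -⟩ := addv_of_twist_pStar p hp2 W V hj hW6 C hC
  obtain ⟨hu, -⟩ := padicValRat_u_eq_zero_and_padicValInt_eq_of_twist_pStar p hp2 W V hW6 C hC
  -- move `D'` to the level `N(W)`
  obtain ⟨D'', hc'', -⟩ := exists_datum_padicVal_eq_of_level_eq hN' p D'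
  -- K₅ at `(W, p, D, χ_{p*})` from the five named inputs, and the loss-free star involution
  have hsat := twistedPeriodLatticeSaturation_five_of_named_inputs hnf hT hWt hKr hEd W p D hpN hp5 hadd hirr hG hV4 hopt
    ((quadraticChar (ZMod p)).ringHomComp (Int.castRingHom ℂ)) (isQuadratic_quadraticChar_ringHomComp p)
    (isPrimitive_quadraticChar_ringHomComp p hp2)
  have hle := padicValInt_c_add_le_of_twist_datum_of_saturation p hp2 W V hadd hV C hC D hopt hpN D'' hsat
  rw [hu, hc''] at hle
  omega

/-! ### §2 The twist's modular degree: `v_p(deg D) + 1 ≤ v_p(deg D')`, so `p ∣ deg(D')` always -/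

/-- **`v_p(deg D) + 1 ≤ v_p(deg D')` for every conductor-level datum `D'` of the `p*`-twist**, under the hypotheses of
`padicValInt_c_le_twist_datum_of_named_inputs` (with `D'` at the level `N(V)`): the `p`-adic twist identity
`v_p(deg D') + 2·v_p(c D) = v_p(deg D) + 2·v_p(c D') + 1` (`Additive.padicVal_twist_identity`, Zagier's degree formula) read with
§1's `v_p(c D) ≤ v_p(c D')`.  Edixhoven's "`deg φ̃ = p·deg φ` in case 2" as an inequality valid for every datum of the twist.
[cite: ZagierCMB1985, §1 (p. 374)] [cite: EdixhovenManin1991, §4 (typescript L1030–1047)] -/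
theorem succ_padicValNat_modularDegree_le_twist_of_named_inputs (hnf : exists_isNewformOf)
    (hT : fullLevelHomology_isIsotypic_tamePrincipalSeries_of_central)
    (hWt : fullLevelHomology_twist_isModular_of_eigenMap_signed)
    (hKr : Kraus1997.propOne_inertiaShape_of_ordinary) (hEd : edixhoven1992_serreWeight_le_weight_of_newform)
    (W : WeierstrassCurve ℚ) [W.IsElliptic] [W.IsGloballyMinimal] (p : ℕ) [Fact p.Prime] [NeZero (W.conductorNorm ℤ)]
    (D : ModularParametrizationData W (W.conductorNorm ℤ)) (hp5 : 5 ≤ p)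
    (hadd : Addv W p) (hirr : Irr W p) (hG : TypeGOrd W p) (hV4 : padicValInt p W.minimalDiscriminantInt ≤ 4)
    (hopt : ∀ z ∈ D.L.lattice, ∃ w ∈ periodLattice D.f, z = D.c * w)
    (V : WeierstrassCurve ℚ) [V.IsElliptic] [V.IsGloballyMinimal] [NeZero (V.conductorNorm ℤ)] (C : VariableChange ℚ)
    (hC : C • W.quadraticTwist ((-1 : ℚ) ^ (p / 2) * p) = V)
    (D' : ModularParametrizationData V (V.conductorNorm ℤ)) :
    padicValNat p D.modularDegree + 1 ≤ padicValNat p D'.modularDegree := by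
  have hp2 : p ≠ 2 := by omega
  have hj : 0 ≤ padicValRat p W.j := padicValRat_j_nonneg_of_typeGOrd W p hG
  have hW6 : padicValInt p W.minimalDiscriminantInt < 6 := by omega
  obtain ⟨hV, -, -⟩ := addv_of_twist_pStar p hp2 W V hj hW6 C hC
  have hN : V.conductorNorm ℤ = W.conductorNorm ℤ := conductorNorm_eq_of_twist_pStar p hp5 W V hadd hV C hC
  have hle := padicValInt_c_le_twist_datum_of_named_inputs hnf hT hWt hKr hEd W p D hp5 hadd hirr hG hV4 hopt V C hC hN D'
  have h := padicVal_twist_identity p hp5 W V hadd hj hW6 C hC D D'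
  change padicValNat p D'.modularDegree + 2 * padicValInt p D.c =
    padicValNat p D.modularDegree + 2 * padicValInt p D'.c + 1 at h
  omega

/-- **`p ∣ deg(D')` for EVERY conductor-level parametrisation datum `D'` of the `p*`-twist** of an unstarred (G)-ordinary optimal
curve with `E[p]` irreducible, at every `p ≥ 5`, granted the five named inputs of K (hypotheses of
`succ_padicValNat_modularDegree_le_twist_of_named_inputs`).  The census law "`p ∣ deg` on the starred partner" without the
hypothesis `p ∤ deg(D)` of `Additive.dvd_modularDegree_twist_of_not_dvd` and without ČNS. [cite: ZagierCMB1985, §1 (p. 374)] -/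
theorem dvd_modularDegree_twist_of_named_inputs (hnf : exists_isNewformOf)
    (hT : fullLevelHomology_isIsotypic_tamePrincipalSeries_of_central)
    (hWt : fullLevelHomology_twist_isModular_of_eigenMap_signed)
    (hKr : Kraus1997.propOne_inertiaShape_of_ordinary) (hEd : edixhoven1992_serreWeight_le_weight_of_newform)
    (W : WeierstrassCurve ℚ) [W.IsElliptic] [W.IsGloballyMinimal] (p : ℕ) [Fact p.Prime] [NeZero (W.conductorNorm ℤ)]
    (D : ModularParametrizationData W (W.conductorNorm ℤ)) (hp5 : 5 ≤ p)
    (hadd : Addv W p) (hirr : Irr W p) (hG : TypeGOrd W p) (hV4 : padicValInt p W.minimalDiscriminantInt ≤ 4)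
    (hopt : ∀ z ∈ D.L.lattice, ∃ w ∈ periodLattice D.f, z = D.c * w)
    (V : WeierstrassCurve ℚ) [V.IsElliptic] [V.IsGloballyMinimal] [NeZero (V.conductorNorm ℤ)] (C : VariableChange ℚ)
    (hC : C • W.quadraticTwist ((-1 : ℚ) ^ (p / 2) * p) = V)
    (D' : ModularParametrizationData V (V.conductorNorm ℤ)) :
    p ∣ D'.modularDegree := by
  have h := succ_padicValNat_modularDegree_le_twist_of_named_inputs hnf hT hWt hKr hEd W p D hp5 hadd hirr hG hV4 hopt V C hC D'
  refine (dvd_iff_padicValNat_ne_zero D'.deg_pos.ne').mpr ?_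
  change padicValNat p D'.modularDegree ≠ 0
  omega

/-! ### §3 Edixhoven's case 2 at every `p ≥ 5`: equal Manin valuations on the optimal star pair -/

/-- **EQUAL MANIN `p`-PARTS ON THE OPTIMAL STAR PAIR (Edixhoven's "case 2", F″-free, every `p ≥ 5`).**  `W/ℚ` globally minimal,
`5 ≤ p`, additive and (G)-ordinary at `p` with `ord_pΔ_min(W) ≤ 4`, `E[p]` irreducible, `D` lattice-optimal at the conductor level
(so `W` is the `X₀`-optimal curve of its class); `W♭/ℚ` globally minimal, additive and potentially good at `p` of STARRED type
(`6 < ord_pΔ_min(W♭)`), the two classes `p*`-twists of each other (`W ⊗ χ_{p*} ∼ W♭`, `W♭ ⊗ χ_{p*} ∼ W`), `D♭` lattice-optimal at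
the conductor level.  GRANTED Modularity and the five named inputs of K: **`ord_p c(D) = ord_p c(D♭)`**.  Lower bound: the
sandwich `padicValInt_c_sandwich_of_optimal_star_pair` (Modularity only); upper bound: §1 at the datum of `W♭` transported
prime-to-`p` to the minimal twist model `V` of `W` (`exists_datum_padicValInt_eq_of_partner`, `E[p]` irreducible).  So of
Edixhoven's two cases (1991 §4, typescript L1039–1047) only CASE 2 occurs for these pairs — at `p ≥ 11` this is his Thm. 3 for the
starred member read backwards; at `p ∈ {5, 7}` it is new in the tree and F″-free.  Nothing is said about the common value.
[cite: EdixhovenManin1991, §4 (typescript L985–L1047)] [cite: Stevens1989, Lemma (5.4) p. 97] -/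
theorem padicValInt_c_eq_of_optimal_star_pair_of_named_inputs (hnf : exists_isNewformOf)
    (hT : fullLevelHomology_isIsotypic_tamePrincipalSeries_of_central)
    (hWt : fullLevelHomology_twist_isModular_of_eigenMap_signed)
    (hKr : Kraus1997.propOne_inertiaShape_of_ordinary) (hEd : edixhoven1992_serreWeight_le_weight_of_newform)
    (W : WeierstrassCurve ℚ) [W.IsElliptic] [W.IsGloballyMinimal] (p : ℕ) [Fact p.Prime] [NeZero (W.conductorNorm ℤ)]
    (D : ModularParametrizationData W (W.conductorNorm ℤ)) (hp5 : 5 ≤ p)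
    (hadd : Addv W p) (hirr : Irr W p) (hG : TypeGOrd W p) (hV4 : padicValInt p W.minimalDiscriminantInt ≤ 4)
    (hopt : ∀ z ∈ D.L.lattice, ∃ w ∈ periodLattice D.f, z = D.c * w)
    (Wf : WeierstrassCurve ℚ) [Wf.IsElliptic] [Wf.IsGloballyMinimal] [NeZero (Wf.conductorNorm ℤ)]
    (hWf : Addv Wf p) (hjWf : 0 ≤ padicValRat p Wf.j) (h6 : 6 < padicValInt p Wf.minimalDiscriminantInt)
    (hVW : IsIsogenous (W.quadraticTwist ((-1 : ℚ) ^ (p / 2) * p)) Wf)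
    (hWV : IsIsogenous (Wf.quadraticTwist ((-1 : ℚ) ^ (p / 2) * p)) W)
    (Df : ModularParametrizationData Wf (Wf.conductorNorm ℤ))
    (hoptf : ∀ z ∈ Df.L.lattice, ∃ w ∈ periodLattice Df.f, z = Df.c * w) :
    padicValInt p D.c = padicValInt p Df.c := by
  have hpP : p.Prime := Fact.out
  have hp2 : p ≠ 2 := by omega
  have hj : 0 ≤ padicValRat p W.j := padicValRat_j_nonneg_of_typeGOrd W p hG
  have hW6 : padicValInt p W.minimalDiscriminantInt < 6 := by omega
  -- lower bound: the sandwich (Modularity only)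
  obtain ⟨hlow, -⟩ := padicValInt_c_sandwich_of_optimal_star_pair p hnf hp5 W Wf hadd hirr hj hW6 hWf hjWf h6 hVW hWV
    D hopt Df hoptf
  -- upper bound: §1 at the datum of `Wf` transported to the minimal twist model `V` of `W`
  obtain ⟨V, hVe, hVm, C, hC⟩ := exists_minimal_twist_pStar p W
  haveI := hVe
  haveI := hVm
  have hd0 : ((-1 : ℚ) ^ (p / 2) * p) ≠ 0 := pStar_ne_zero p
  obtain ⟨hV, -, -⟩ := addv_of_twist_pStar p hp2 W V hj hW6 C hC
  have hirrV : Irr V p :=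
    BurungaleSkinnerTianWan2024.hasIrreducibleModPGaloisRep_of_smul_eq_quadraticTwist W V p hd0 (C := C⁻¹)
      (by rw [← hC, inv_smul_smul]) hirr
  have hiso : IsIsogenous V Wf := (isIsogenous_of_smul_eq' hC).trans' hVW
  obtain ⟨Dt, hDt⟩ := exists_datum_padicValInt_eq_of_partner V hpP hirrV hiso Df
  have hNt : Wf.conductorNorm ℤ = V.conductorNorm ℤ :=
    IsNewformOf.level_eq_conductorNorm_of_exists_isNewformOf hnf Dt.isNewformOf
  have hNV : V.conductorNorm ℤ = W.conductorNorm ℤ := conductorNorm_eq_of_twist_pStar p hp5 W V hadd hV C hC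
  have hup := padicValInt_c_le_twist_datum_of_named_inputs hnf hT hWt hKr hEd W p D hp5 hadd hirr hG hV4 hopt V C hC
    (hNt.trans hNV) Dt
  rw [hDt] at hup
  exact le_antisymm hup hlow

/-- **The unstarred optimal Manin unit ⟺ the starred optimal partner's Manin unit** (hypotheses of
`padicValInt_c_eq_of_optimal_star_pair_of_named_inputs`): `p ∤ c(D) ↔ p ∤ c(D♭)`.  The direction `←` is g29's
`not_dvd_c_of_named_inputs_of_starredClass` (K-line transfer), `→` the tree's star involution
(`StarInvolution.not_dvd_c_of_twist_datum`, Modularity); packaged as one equivalence.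
[cite: EdixhovenManin1991, §4 (typescript L985–L1047)] -/
theorem not_dvd_c_iff_of_optimal_star_pair_of_named_inputs (hnf : exists_isNewformOf)
    (hT : fullLevelHomology_isIsotypic_tamePrincipalSeries_of_central)
    (hWt : fullLevelHomology_twist_isModular_of_eigenMap_signed)
    (hKr : Kraus1997.propOne_inertiaShape_of_ordinary) (hEd : edixhoven1992_serreWeight_le_weight_of_newform)
    (W : WeierstrassCurve ℚ) [W.IsElliptic] [W.IsGloballyMinimal] (p : ℕ) [Fact p.Prime] [NeZero (W.conductorNorm ℤ)]
    (D : ModularParametrizationData W (W.conductorNorm ℤ)) (hp5 : 5 ≤ p)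
    (hadd : Addv W p) (hirr : Irr W p) (hG : TypeGOrd W p) (hV4 : padicValInt p W.minimalDiscriminantInt ≤ 4)
    (hopt : ∀ z ∈ D.L.lattice, ∃ w ∈ periodLattice D.f, z = D.c * w)
    (Wf : WeierstrassCurve ℚ) [Wf.IsElliptic] [Wf.IsGloballyMinimal] [NeZero (Wf.conductorNorm ℤ)]
    (hWf : Addv Wf p) (hjWf : 0 ≤ padicValRat p Wf.j) (h6 : 6 < padicValInt p Wf.minimalDiscriminantInt)
    (hVW : IsIsogenous (W.quadraticTwist ((-1 : ℚ) ^ (p / 2) * p)) Wf)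
    (hWV : IsIsogenous (Wf.quadraticTwist ((-1 : ℚ) ^ (p / 2) * p)) W)
    (Df : ModularParametrizationData Wf (Wf.conductorNorm ℤ))
    (hoptf : ∀ z ∈ Df.L.lattice, ∃ w ∈ periodLattice Df.f, z = Df.c * w) :
    ¬ (p : ℤ) ∣ D.c ↔ ¬ (p : ℤ) ∣ Df.c := by
  have heq := padicValInt_c_eq_of_optimal_star_pair_of_named_inputs hnf hT hWt hKr hEd W p D hp5 hadd hirr hG hV4 hopt
    Wf hWf hjWf h6 hVW hWV Df hoptf
  have hc0 : D.c ≠ 0 := D.maninConstant_ne_zero_holds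
  have hcf0 : Df.c ≠ 0 := Df.maninConstant_ne_zero_holds
  have h1 : (p : ℤ) ∣ D.c ↔ 1 ≤ padicValInt p D.c := by
    rw [← pow_one (p : ℤ), padicValInt_dvd_iff]
    exact ⟨fun h ↦ h.resolve_left hc0, Or.inr⟩
  have h2 : (p : ℤ) ∣ Df.c ↔ 1 ≤ padicValInt p Df.c := by
    rw [← pow_one (p : ℤ), padicValInt_dvd_iff]
    exact ⟨fun h ↦ h.resolve_left hcf0, Or.inr⟩
  rw [h1, h2, heq]

/-! ### §4 At the Kummer corner (the binders of CORNER 23883 / WILD 24306 / TAME 24307) -/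

/-- **At the Kummer corner the unstarred optimal curve and its starred optimal partner have the SAME Manin `p`-part**
(`(p, ord_pΔ_min) ∈ {(5, 3), (7, 2)}`: Kodaira III at 5 with partner III*, II at 7 with partner IV*; additive, (G)-ordinary,
`E[p]` irreducible, a `ℚ_p`-rational `p`-torsion point (unused), `D` lattice-optimal; `(W♭, D♭)` the starred optimal partner as in
`padicValInt_c_eq_of_optimal_star_pair_of_named_inputs`), GRANTED Modularity and the five named inputs of K.  CORNER itself is NOT
proved: the common value is not shown to be `0` (that is the starred Kummer corner / Edixhoven's geometric step at `e = p − 1`,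
seat memo KLINE-EDIX7-ttdp1g30.md).  BSD is not proved by this. [cite: EdixhovenManin1991, §4 and Thm. 3] -/
theorem kummerCorner_padicValInt_c_eq_starred_of_named_inputs (hnf : exists_isNewformOf)
    (hT : fullLevelHomology_isIsotypic_tamePrincipalSeries_of_central)
    (hWt : fullLevelHomology_twist_isModular_of_eigenMap_signed)
    (hKr : Kraus1997.propOne_inertiaShape_of_ordinary) (hEd : edixhoven1992_serreWeight_le_weight_of_newform)
    (W : WeierstrassCurve ℚ) [W.IsElliptic] [W.IsGloballyMinimal] (p : ℕ) [Fact p.Prime] [NeZero (W.conductorNorm ℤ)]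
    (D : ModularParametrizationData W (W.conductorNorm ℤ))
    (hcell : (p = 5 ∧ padicValInt p W.minimalDiscriminantInt = 3) ∨ (p = 7 ∧ padicValInt p W.minimalDiscriminantInt = 2))
    (hadd : Addv W p) (hirr : Irr W p) (hG : TypeGOrd W p)
    (_htor : ∃ P : (W.baseChange ℚ_[p]).toAffine.Point, p • P = 0 ∧ P ≠ 0)
    (hopt : ∀ z ∈ D.L.lattice, ∃ w ∈ periodLattice D.f, z = D.c * w)
    (Wf : WeierstrassCurve ℚ) [Wf.IsElliptic] [Wf.IsGloballyMinimal] [NeZero (Wf.conductorNorm ℤ)]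
    (hWf : Addv Wf p) (hjWf : 0 ≤ padicValRat p Wf.j) (h6 : 6 < padicValInt p Wf.minimalDiscriminantInt)
    (hVW : IsIsogenous (W.quadraticTwist ((-1 : ℚ) ^ (p / 2) * p)) Wf)
    (hWV : IsIsogenous (Wf.quadraticTwist ((-1 : ℚ) ^ (p / 2) * p)) W)
    (Df : ModularParametrizationData Wf (Wf.conductorNorm ℤ))
    (hoptf : ∀ z ∈ Df.L.lattice, ∃ w ∈ periodLattice Df.f, z = Df.c * w) :
    padicValInt p D.c = padicValInt p Df.c := by
  have hp5 : 5 ≤ p := by rcases hcell with ⟨rfl, -⟩ | ⟨rfl, -⟩ <;> norm_num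
  have hV4 : padicValInt p W.minimalDiscriminantInt ≤ 4 := by rcases hcell with ⟨-, h⟩ | ⟨-, h⟩ <;> omega
  exact padicValInt_c_eq_of_optimal_star_pair_of_named_inputs hnf hT hWt hKr hEd W p D hp5 hadd hirr hG hV4 hopt
    Wf hWf hjWf h6 hVW hWV Df hoptf

/-- **At the Kummer corner every parametrisation datum of the `p*`-twist has modular degree divisible by `p`** (CORNER's binders;
`V = C • W ⊗ χ_{p*}` globally minimal, `D'` any conductor-level datum of `V`), GRANTED Modularity and the five named inputs of K;
moreover `v_p(deg D') ≥ v_p(deg D) + 1`.  BSD is not proved by this. [cite: ZagierCMB1985, §1 (p. 374)] -/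
theorem kummerCorner_dvd_modularDegree_twist_of_named_inputs (hnf : exists_isNewformOf)
    (hT : fullLevelHomology_isIsotypic_tamePrincipalSeries_of_central)
    (hWt : fullLevelHomology_twist_isModular_of_eigenMap_signed)
    (hKr : Kraus1997.propOne_inertiaShape_of_ordinary) (hEd : edixhoven1992_serreWeight_le_weight_of_newform)
    (W : WeierstrassCurve ℚ) [W.IsElliptic] [W.IsGloballyMinimal] (p : ℕ) [Fact p.Prime] [NeZero (W.conductorNorm ℤ)]
    (D : ModularParametrizationData W (W.conductorNorm ℤ))
    (hcell : (p = 5 ∧ padicValInt p W.minimalDiscriminantInt = 3) ∨ (p = 7 ∧ padicValInt p W.minimalDiscriminantInt = 2))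
    (hadd : Addv W p) (hirr : Irr W p) (hG : TypeGOrd W p)
    (_htor : ∃ P : (W.baseChange ℚ_[p]).toAffine.Point, p • P = 0 ∧ P ≠ 0)
    (hopt : ∀ z ∈ D.L.lattice, ∃ w ∈ periodLattice D.f, z = D.c * w)
    (V : WeierstrassCurve ℚ) [V.IsElliptic] [V.IsGloballyMinimal] [NeZero (V.conductorNorm ℤ)] (C : VariableChange ℚ)
    (hC : C • W.quadraticTwist ((-1 : ℚ) ^ (p / 2) * p) = V)
    (D' : ModularParametrizationData V (V.conductorNorm ℤ)) :
    padicValNat p D.modularDegree + 1 ≤ padicValNat p D'.modularDegree ∧ p ∣ D'.modularDegree := by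
  have hp5 : 5 ≤ p := by rcases hcell with ⟨rfl, -⟩ | ⟨rfl, -⟩ <;> norm_num
  have hV4 : padicValInt p W.minimalDiscriminantInt ≤ 4 := by rcases hcell with ⟨-, h⟩ | ⟨-, h⟩ <;> omega
  exact ⟨succ_padicValNat_modularDegree_le_twist_of_named_inputs hnf hT hWt hKr hEd W p D hp5 hadd hirr hG hV4 hopt V C hC D',
    dvd_modularDegree_twist_of_named_inputs hnf hT hWt hKr hEd W p D hp5 hadd hirr hG hV4 hopt V C hC D'⟩

/-! ### §5 Appended (same seat, g30): the degree law on the optimal star pair when the starred optimal curve is a twist MODEL -/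

/-- **`v_p(deg D♭) = v_p(deg D) + 1` on the optimal star pair whose starred optimal curve IS a minimal model of the `p*`-twist**
(`C • W ⊗ χ_{p*} = W♭`, Edixhoven's situation "the twist of the strong curve is strong", automatic for `E[p]` irreducible non-CM by his
lattice trichotomy; hypotheses otherwise as in `padicValInt_c_eq_of_optimal_star_pair_of_named_inputs`): the `p`-adic twist identity
`v_p(deg D♭) + 2·v_p(c D) = v_p(deg D) + 2·v_p(c D♭) + 1` (`Additive.padicVal_twist_identity`, Zagier) read with §3's equality.  This is
Edixhoven's case-2 degree relation `deg φ̃ = p·deg φ` (1991 §4, typescript L1039–1047) on `p`-adic valuations, at every `p ≥ 5`, F″-free —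
the sign `ε = −1` (w.r.t. the starred member) of thesis Prop. 4.5.2.  BSD is not proved by this; no item is closed.
[cite: EdixhovenManin1991, §4 (typescript L1039–1047)] [cite: ZagierCMB1985, §1 (p. 374)] -/
theorem padicValNat_modularDegree_starred_eq_succ_of_named_inputs (hnf : exists_isNewformOf)
    (hT : fullLevelHomology_isIsotypic_tamePrincipalSeries_of_central)
    (hWt : fullLevelHomology_twist_isModular_of_eigenMap_signed)
    (hKr : Kraus1997.propOne_inertiaShape_of_ordinary) (hEd : edixhoven1992_serreWeight_le_weight_of_newform)
    (W : WeierstrassCurve ℚ) [W.IsElliptic] [W.IsGloballyMinimal] (p : ℕ) [Fact p.Prime] [NeZero (W.conductorNorm ℤ)]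
    (D : ModularParametrizationData W (W.conductorNorm ℤ)) (hp5 : 5 ≤ p)
    (hadd : Addv W p) (hirr : Irr W p) (hG : TypeGOrd W p) (hV4 : padicValInt p W.minimalDiscriminantInt ≤ 4)
    (hopt : ∀ z ∈ D.L.lattice, ∃ w ∈ periodLattice D.f, z = D.c * w)
    (Wf : WeierstrassCurve ℚ) [Wf.IsElliptic] [Wf.IsGloballyMinimal] [NeZero (Wf.conductorNorm ℤ)]
    (C : VariableChange ℚ) (hC : C • W.quadraticTwist ((-1 : ℚ) ^ (p / 2) * p) = Wf)
    (hWf : Addv Wf p) (hjWf : 0 ≤ padicValRat p Wf.j) (h6 : 6 < padicValInt p Wf.minimalDiscriminantInt)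
    (hVW : IsIsogenous (W.quadraticTwist ((-1 : ℚ) ^ (p / 2) * p)) Wf)
    (hWV : IsIsogenous (Wf.quadraticTwist ((-1 : ℚ) ^ (p / 2) * p)) W)
    (Df : ModularParametrizationData Wf (Wf.conductorNorm ℤ))
    (hoptf : ∀ z ∈ Df.L.lattice, ∃ w ∈ periodLattice Df.f, z = Df.c * w) :
    padicValNat p Df.modularDegree = padicValNat p D.modularDegree + 1 := by
  have hj : 0 ≤ padicValRat p W.j := padicValRat_j_nonneg_of_typeGOrd W p hG
  have hW6 : padicValInt p W.minimalDiscriminantInt < 6 := by omega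
  have heq := padicValInt_c_eq_of_optimal_star_pair_of_named_inputs hnf hT hWt hKr hEd W p D hp5 hadd hirr hG hV4 hopt
    Wf hWf hjWf h6 hVW hWV Df hoptf
  have h := padicVal_twist_identity p hp5 W Wf hadd hj hW6 C hC D Df
  change padicValNat p Df.modularDegree + 2 * padicValInt p D.c =
    padicValNat p D.modularDegree + 2 * padicValInt p Df.c + 1 at h
  omega

end KFive

end Summit.BirchSwinnertonDyer.BirchSwinnertonDyer.Theorems.TeichmullerTwistDescent

end
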